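import Mathlib.GroupTheory.SpecificGroups.Cyclic
import Literature.AnabelianGeometry.EtaleTheta.BiKummerDef22Context
import Literature.AnabelianGeometry.EtaleTheta.Discharge.Sec4Prop42SubLawsOfDef22Reading
import Literature.AnabelianGeometry.EtaleTheta.Discharge.Sec5OfConnectedTemperoid
import HarnessLib

/-!
# [EtTh] Prop 4.2 (iii)/(iv): the Def 2.2 reading laws `hmu` / `hgal` AT THE CONTEXT `def22Ctx` (proof-only)

S. Mochizuki, *The étale theta function …* [MochizukiEtTh2009], Def 4.1 (ii) p.87 («`μ_N`-saturated» = [FrdII] Def 2.1 (i)),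
Prop 4.2 pp.88–90; *The geometry of Frobenioids II* [MochizukiFrdII2008], Def 2.1 (i) p.16 («the abstract group `μ_N(A)` is
isomorphic to `ℤ/Nℤ`»), Def 2.2 (i)/(ii) p.17.

abc-iut-w6-d047 (gen 3).  abc-iut-w4-d044's `Sec4Prop42SubLawsOfDef22Reading` (p457351) re-keys the two GAP laws `hL` (G-w4d044-1) /
`hE` (G-w4d044-2) of [EtTh] Prop 4.2 (iii)/(iv) on an ABSTRACT family of [FrdII] Def 2.2 contexts `ctx : S.C → Def22Context` with
reading laws; among its binders are the two clause-readings (a) `hmu : Kummer.IsMuSaturated N (ctx A).O → S.IsMuSaturated A N` and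
(b) `hgal : (ctx A).isGalois → S.IsGalois A`.  AT THE CONTEXT OF RECORD `ctx := TemperedFrobenioid.def22Ctx` (p460958, `O := ↥O^×(A)`,
`isGalois := «A^bs Galois»`) BOTH ARE THEOREMS:
* `TemperedFrobenioid.isMuSaturated_iff_kummer` — for ANY tempered Frobenioid and object `A`, [EtTh]'s «`μ_N(A)` is generated by
  an element of order `N`» (`TemperedFrobenioid.IsMuSaturated`, abc-iut-L2-t3) ⟺ [FrdII] Def 2.1 (i) «`μ_N(O^×(A)) ≅ ℤ/Nℤ` as
  abstract groups» (abc-iut-L1's `Kummer.IsMuSaturated N ↥O^×(A)`) — cyclic-group bookkeeping along the injection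
  `μ_N(↥O^×(A)) ↪ Aut_C(A)`;
* `BiKummerSetting.isGalois_of_def22Ctx_isGalois` — (b) is `rfl` at `mkOfConnectedTemperoid`;
* corollaries: `Prop42Sub.refinementLaw_of_def22Ctx` (`hE` ⟸ {reading `hNH'`, [FrdII] Rmk 2.2.1 existence `hex`} only) and the joint
  node floor `Prop42Sub.prop42_iii_iv_mkOfConnectedTemperoid_of_def22Ctx` (p457351's floor with `hmu`/`hgal` DISCHARGED).
PROOF-ONLY (0 definitions).  HONEST FRAMING: refereed pre-IUT material; typed ≠ proved for the remaining binders; nothing here bears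
on [IUTchIII] Cor 3.12.
-/

noncomputable section

namespace Literature.AnabelianGeometry.EtaleTheta

open CategoryTheory Opposite Literature.AlgebraicGeometry.Frobenioids Literature.AnabelianGeometry.SemiGraphs
  Literature.AnabelianGeometry.SemiGraphs.GaloisObjects

/-! ### §A. `μ_N`-saturation at `def22Ctx`: [EtTh] Def 4.1 (ii) ⟺ [FrdII] Def 2.1 (i) read on `(def22Ctx A).O = ↥O^×(A)` -/

namespace TemperedFrobenioid

variable {K : Type} [Field K] (X : TemperedArithmeticGroup.{0} K) {D₀ : Type} [Category.{0} D₀]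
  {V : FrdIMonoidStub.{0}} {T₀ : RealifiedDivisorMonoids (D₀ := D₀) V}
  {VD : FrdICatStub.{1, 0, 0} (ConnectedPart (BTemp X.Pi))}
  (tf : TemperedFrobenioid T₀ (ConnectedPart (BTemp X.Pi)) VD) (haug : IsOpenMap X.aug) (A : tf.category)
  (act : MulDistribMulAction (Aut (AE X tf haug A)) ↥(tf.units A))
  (hact : ∀ (α : Aut A) (u : ↥(tf.units A)),
    (resE X tf haug A α) • u = (⟨α * u.1 * α⁻¹, (tf.units_normal A).conj_mem _ u.2 α⟩ : ↥(tf.units A)))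
  (H : Subgroup (Field.absoluteGaloisGroup K)) (hHn : H.Normal) (hHo : IsOpen (H : Set (Field.absoluteGaloisGroup K)))

/-- `(def22Ctx A).O = ↥O^×(A)` (definitionally). [cite: MochizukiFrdII2008, Def 2.2 (i) p.17] -/
theorem def22Ctx_O : (def22Ctx X tf haug A act hact H hHn hHo).O = ↥(tf.units A) := rfl

/-- **[EtTh] Def 4.1 (ii) «`μ_N`-saturated» ⟸ [FrdII] Def 2.1 (i) on `(def22Ctx A).O = ↥O^×(A)`**: an abstract isomorphism
`μ_N(↥O^×(A)) ≅ ℤ/Nℤ` gives a generator of `μ_N(A) ⊆ Aut_C(A)` of order `N` (the image of `1 ∈ ℤ/Nℤ` under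
`μ_N(↥O^×(A)) ↪ Aut_C(A)`). [cite: MochizukiFrdII2008, Def 2.1 (i) p.16] -/
theorem isMuSaturated_of_kummer_def22Ctx (N : ℕ+)
    (h : Kummer.IsMuSaturated (N : ℕ) (def22Ctx X tf haug A act hact H hHn hHo).O) : tf.IsMuSaturated A N := by
  obtain ⟨⟨e⟩⟩ := h
  -- the injection `μ_N(↥O^×(A)) ↪ Aut_C(A)`
  let j : Kummer.Mu (N : ℕ) (def22Ctx X tf haug A act hact H hHn hHo).O →* Aut A :=
    { toFun := fun ζ => (show ↥(tf.units A) from ((ζ.val : ((def22Ctx X tf haug A act hact H hHn hHo).O)ˣ) :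
          (def22Ctx X tf haug A act hact H hHn hHo).O)).1
      map_one' := by rw [Kummer.Mu.val_one, Units.val_one]; rfl
      map_mul' := fun ζ ξ => by rw [Kummer.Mu.val_mul, Units.val_mul]; rfl }
  have hj : Function.Injective j := fun ζ ξ hζξ => Kummer.Mu.ext (Units.ext (Subtype.ext hζξ))
  have hjmem : ∀ ζ, j ζ ∈ tf.units A := fun ζ =>
    (show ↥(tf.units A) from ((ζ.val : ((def22Ctx X tf haug A act hact H hHn hHo).O)ˣ) :
      (def22Ctx X tf haug A act hact H hHn hHo).O)).2
  have hjpow : ∀ ζ, j ζ ^ (N : ℕ) = 1 := fun ζ => by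
    have h0 : (ζ.val : ((def22Ctx X tf haug A act hact H hHn hHo).O)ˣ) ^ (N : ℕ) = 1 :=
      (mem_rootsOfUnity _ _).mp ζ.val_mem
    have h1 : ((ζ.val ^ (N : ℕ) : ((def22Ctx X tf haug A act hact H hHn hHo).O)ˣ) :
        (def22Ctx X tf haug A act hact H hHn hHo).O) = 1 := by
      rw [h0, Units.val_one]
    exact congrArg Subtype.val h1
  set g := e.symm (Multiplicative.ofAdd (1 : ZMod N)) with hg
  have hordg : orderOf g = (N : ℕ) := by
    rw [hg, MulEquiv.orderOf_eq, orderOf_ofAdd_eq_addOrderOf, ZMod.addOrderOf_one]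
  refine ⟨j g, ⟨hjmem g, hjpow g⟩, ?_, fun τ hτ => ?_⟩
  · rw [orderOf_injective j hj g, hordg]
  · -- `τ ∈ μ_N(A)` is `j ζ` for the torsion unit `ζ := τ`
    let u : ((def22Ctx X tf haug A act hact H hHn hHo).O)ˣ :=
      ⟨(show ↥(tf.units A) from ⟨τ, hτ.1⟩), (show ↥(tf.units A) from ⟨τ⁻¹, inv_mem hτ.1⟩),
        Subtype.ext (mul_inv_cancel τ), Subtype.ext (inv_mul_cancel τ)⟩
    have hu : u ∈ rootsOfUnity (N : ℕ) (def22Ctx X tf haug A act hact H hHn hHo).O :=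
      (mem_rootsOfUnity _ _).mpr (Units.ext (Subtype.ext (show τ ^ (N : ℕ) = 1 from hτ.2)))
    have hζ : j (Kummer.Mu.mk u hu) = τ := rfl
    -- `e ζ = (ofAdd 1)^m` for `m := (toAdd (e ζ)).val`
    have hζg : Kummer.Mu.mk u hu = g ^ (ZMod.val (Multiplicative.toAdd (e (Kummer.Mu.mk u hu)))) := by
      apply e.injective
      rw [map_pow, hg, MulEquiv.apply_symm_apply, ← ofAdd_nsmul, nsmul_one, ZMod.natCast_zmod_val]
      rfl
    rw [← hζ, hζg, map_pow]
    exact Subgroup.npow_mem_zpowers _ _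

/-- **[EtTh] Def 4.1 (ii) «`μ_N`-saturated» ⟹ [FrdII] Def 2.1 (i) on `(def22Ctx A).O = ↥O^×(A)`**: a generator of `μ_N(A)` of
order `N` makes `μ_N(↥O^×(A))` cyclic of order `N`, hence abstractly `≅ ℤ/Nℤ`. [cite: MochizukiFrdII2008, Def 2.1 (i) p.16] -/
theorem kummer_def22Ctx_isMuSaturated_of (N : ℕ+) (h : tf.IsMuSaturated A N) :
    Kummer.IsMuSaturated (N : ℕ) (def22Ctx X tf haug A act hact H hHn hHo).O := by
  obtain ⟨σ, hσ, hord, hgen⟩ := h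
  let j : Kummer.Mu (N : ℕ) (def22Ctx X tf haug A act hact H hHn hHo).O →* Aut A :=
    { toFun := fun ζ => (show ↥(tf.units A) from ((ζ.val : ((def22Ctx X tf haug A act hact H hHn hHo).O)ˣ) :
          (def22Ctx X tf haug A act hact H hHn hHo).O)).1
      map_one' := by rw [Kummer.Mu.val_one, Units.val_one]; rfl
      map_mul' := fun ζ ξ => by rw [Kummer.Mu.val_mul, Units.val_mul]; rfl }
  have hj : Function.Injective j := fun ζ ξ hζξ => Kummer.Mu.ext (Units.ext (Subtype.ext hζξ))
  have hjmem : ∀ ζ, j ζ ∈ tf.mu A N := fun ζ =>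
    ⟨(show ↥(tf.units A) from ((ζ.val : ((def22Ctx X tf haug A act hact H hHn hHo).O)ˣ) :
      (def22Ctx X tf haug A act hact H hHn hHo).O)).2, by
      have h0 : (ζ.val : ((def22Ctx X tf haug A act hact H hHn hHo).O)ˣ) ^ (N : ℕ) = 1 :=
        (mem_rootsOfUnity _ _).mp ζ.val_mem
      have h1 : ((ζ.val ^ (N : ℕ) : ((def22Ctx X tf haug A act hact H hHn hHo).O)ˣ) :
          (def22Ctx X tf haug A act hact H hHn hHo).O) = 1 := by
        rw [h0, Units.val_one]
      exact congrArg Subtype.val h1⟩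
  let u : ((def22Ctx X tf haug A act hact H hHn hHo).O)ˣ :=
    ⟨(show ↥(tf.units A) from ⟨σ, hσ.1⟩), (show ↥(tf.units A) from ⟨σ⁻¹, inv_mem hσ.1⟩),
      Subtype.ext (mul_inv_cancel σ), Subtype.ext (inv_mul_cancel σ)⟩
  have hu : u ∈ rootsOfUnity (N : ℕ) (def22Ctx X tf haug A act hact H hHn hHo).O :=
    (mem_rootsOfUnity _ _).mpr (Units.ext (Subtype.ext (show σ ^ (N : ℕ) = 1 from hσ.2)))
  have hg₀ : j (Kummer.Mu.mk u hu) = σ := rfl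
  -- every torsion unit is a power of `g₀ := σ` (read in `Aut_C(A)`, where `μ_N(A) ⊆ ⟨σ⟩`)
  have hcyc : ∀ ζ, ζ ∈ Subgroup.zpowers (Kummer.Mu.mk u hu) := by
    intro ζ
    obtain ⟨k, hk⟩ := Subgroup.mem_zpowers_iff.mp (hgen _ (hjmem ζ))
    refine Subgroup.mem_zpowers_iff.mpr ⟨k, hj ?_⟩
    rw [map_zpow, hg₀, hk]
  haveI : IsCyclic (Kummer.Mu (N : ℕ) (def22Ctx X tf haug A act hact H hHn hHo).O) :=
    isCyclic_iff_exists_zpowers_eq_top.mpr ⟨_, (Subgroup.zpowers _).eq_top_iff'.mpr hcyc⟩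
  have hcard : Nat.card (Kummer.Mu (N : ℕ) (def22Ctx X tf haug A act hact H hHn hHo).O) =
      Nat.card (Multiplicative (ZMod N)) := by
    rw [← orderOf_eq_card_of_forall_mem_zpowers hcyc, ← orderOf_injective j hj, hg₀, hord, Nat.card_eq_fintype_card,
      Fintype.card_multiplicative, ZMod.card]
  exact ⟨⟨mulEquivOfCyclicCardEq hcard⟩⟩

/-- **[EtTh] Def 4.1 (ii) ⟺ [FrdII] Def 2.1 (i) at `def22Ctx`**: `A` is `μ_N`-saturated in the sense of the tempered-Frobenioid typing
(a generator of `μ_N(A) ⊆ Aut_C(A)` of order `N`) iff the abstract group `μ_N((def22Ctx A).O) = μ_N(↥O^×(A))` is isomorphic to `ℤ/Nℤ`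
— clause (a) of the [FrdII] Def 2.2 (ii) dictionary. [cite: MochizukiFrdII2008, Def 2.1 (i) p.16] -/
theorem isMuSaturated_iff_kummer_def22Ctx (N : ℕ+) :
    tf.IsMuSaturated A N ↔ Kummer.IsMuSaturated (N : ℕ) (def22Ctx X tf haug A act hact H hHn hHo).O :=
  ⟨tf.kummer_def22Ctx_isMuSaturated_of X haug A act hact H hHn hHo N,
    tf.isMuSaturated_of_kummer_def22Ctx X haug A act hact H hHn hHo N⟩

end TemperedFrobenioid

/-! ### §B. At the context of record `def22Ctx` over `B^temp(Π^tp_X)⁰` -/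

namespace BiKummerSetting

variable {K : Type} [Field K] {X : SemiGraphs.TemperedArithmeticGroup.{0} K} {D₀ : Type} [Category.{0} D₀]
  {V : FrdIMonoidStub.{0}} {T₀ : RealifiedDivisorMonoids (D₀ := D₀) V}
  {VD : FrdICatStub.{1, 0, 0} (ConnectedPart (BTemp X.Pi))}
  {tf : TemperedFrobenioid T₀ (ConnectedPart (BTemp X.Pi)) VD} {hZ : tf.monoidType = MonoidType.Z}
  {hP : ∀ A : (ConnectedPart (BTemp X.Pi))ᵒᵖ, IsPerfect (tf.Φ.carrier A)}
  {NH : Subgroup (Field.absoluteGaloisGroup K) → tf.category → ℕ+ → Prop} {A₀ : tf.category}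
  {hA₀ : PreFrobenioid.IsFrobeniusTrivial tf.toElem A₀} {hA₀' : SemiGraphs.IsGaloisObj A₀.base.obj}
  (haug : IsOpenMap X.aug)
  (act : ∀ A : tf.category, MulDistribMulAction (Aut (TemperedFrobenioid.AE X tf haug A)) ↥(tf.units A))
  (hact : ∀ (A : tf.category) (α : Aut A) (u : ↥(tf.units A)),
    (TemperedFrobenioid.resE X tf haug A α) • u = (⟨α * u.1 * α⁻¹, (tf.units_normal A).conj_mem _ u.2 α⟩ : ↥(tf.units A)))
  (H : Subgroup (Field.absoluteGaloisGroup K)) (hHn : H.Normal) (hHo : IsOpen (H : Set (Field.absoluteGaloisGroup K)))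

/-- **Clause (b) of the dictionary at `def22Ctx` is `rfl`**: `(def22Ctx A).isGalois` = «`A^bs` Galois» = `S.IsGalois A` for the setting
`mkOfConnectedTemperoid`. [cite: MochizukiFrdII2008, Def 2.2 (ii) p.17] -/
theorem isGalois_of_def22Ctx_isGalois (A : tf.category)
    (h : (TemperedFrobenioid.def22Ctx X tf haug A (act A) (hact A) H hHn hHo).isGalois) :
    (mkOfConnectedTemperoid X tf hZ hP NH A₀ hA₀ hA₀').IsGalois A :=
  h

/-- **Clause (a) of the dictionary at `def22Ctx` is a theorem**: `Kummer.IsMuSaturated N (def22Ctx A).O → S.IsMuSaturated A N`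
(`(def22Ctx A).O = ↥O^×(A)`; `TemperedFrobenioid.isMuSaturated_of_kummer_def22Ctx`). [cite: MochizukiFrdII2008, Def 2.2 (ii) p.17] -/
theorem isMuSaturated_of_def22Ctx_isMuSaturated (A : tf.category) (N : ℕ+)
    (h : Kummer.IsMuSaturated (N : ℕ) (TemperedFrobenioid.def22Ctx X tf haug A (act A) (hact A) H hHn hHo).O) :
    (mkOfConnectedTemperoid X tf hZ hP NH A₀ hA₀ hA₀').IsMuSaturated A N :=
  tf.isMuSaturated_of_kummer_def22Ctx X haug A (act A) (hact A) H hHn hHo N h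

/-- **`hE` (GAP G-w4d044-2) AT `def22Ctx`** ⟸ {the reading `hNH'` of the free slot through `def22Ctx` (at `H := H^{bs-fld}_⊙`), [FrdII]
Rmk 2.2.1 existence of saturated pull-backs read in `C` (`hex`)} — abc-iut-w4-d044's `refinementLaw_of_def22Reading` with its clause
readings `hgal`/`hmu` DISCHARGED. [cite: MochizukiEtTh2009, Prop 4.2 p.90] -/
theorem Prop42Sub.refinementLaw_of_def22Ctx
    (hHn : (mkOfConnectedTemperoid X tf hZ hP NH A₀ hA₀ hA₀').HodotBsFld.Normal)
    (hHo : IsOpen ((mkOfConnectedTemperoid X tf hZ hP NH A₀ hA₀ hA₀').HodotBsFld : Set (Field.absoluteGaloisGroup K)))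
    (hNH' : ∀ (A : tf.category) (N : ℕ+),
      PadicKummer.IsNHSaturated (TemperedFrobenioid.def22Ctx X tf haug A (act A) (hact A)
        (mkOfConnectedTemperoid X tf hZ hP NH A₀ hA₀ hA₀').HodotBsFld hHn hHo) N →
        NH (mkOfConnectedTemperoid X tf hZ hP NH A₀ hA₀ hA₀').HodotBsFld A N)
    (hex : ∀ (A' : tf.category) (N : ℕ+), ∃ (A'' : tf.category) (ψ : A'' ⟶ A'),
      PreFrobenioid.IsPullbackMorphism tf.toElem ψ ∧
        PadicKummer.IsNHSaturated (TemperedFrobenioid.def22Ctx X tf haug A'' (act A'') (hact A'')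
          (mkOfConnectedTemperoid X tf hZ hP NH A₀ hA₀ hA₀').HodotBsFld hHn hHo) N) :
    ∀ (N : ℕ+) (A' : tf.category), PreFrobenioid.IsFrobeniusTrivial tf.toElem A' →
      (mkOfConnectedTemperoid X tf hZ hP NH A₀ hA₀ hA₀').IsGalois A' →
      ∃ (A'' : tf.category) (ψ : A'' ⟶ A'), PreFrobenioid.IsPullbackMorphism tf.toElem ψ ∧
        (mkOfConnectedTemperoid X tf hZ hP NH A₀ hA₀ hA₀').IsGalois A'' ∧
        (mkOfConnectedTemperoid X tf hZ hP NH A₀ hA₀ hA₀').IsMuSaturated A'' N ∧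
        NH (mkOfConnectedTemperoid X tf hZ hP NH A₀ hA₀ hA₀').HodotBsFld A'' N :=
  Prop42Sub.refinementLaw_of_def22Reading (mkOfConnectedTemperoid X tf hZ hP NH A₀ hA₀ hA₀')
    (fun A => TemperedFrobenioid.def22Ctx X tf haug A (act A) (hact A) _ hHn hHo) hNH'
    (fun A h => isGalois_of_def22Ctx_isGalois haug act hact _ hHn hHo A h)
    (fun A N h => isMuSaturated_of_def22Ctx_isMuSaturated haug act hact _ hHn hHo A N h) hex

/-- **[EtTh] Prop 4.2 (iii) ∧ (iv) AS TYPED at the genuine connected base `B^temp(Π^tp_X)⁰` (`mkOfConnectedTemperoid`) AT THE CONTEXT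
`def22Ctx` — abc-iut-w4-d044's joint node floor `prop42_iii_iv_mkOfModelCanonical_of_def22Reading` (p457351) with the clause readings
`hgal` (rfl) and `hmu` (`isMuSaturated_of_kummer_def22Ctx`) DISCHARGED**: ⟸ {`Φ` divisorial, `hDSpull` ([FrdI] Prop 4.1 (iii)), `hR`
(root law, G-w4d044-3), `hS` (Def 4.1 (ii) naturality)} ∪ {the READING both ways `hNH`/`hNH'` of the free slot through `def22Ctx` at
`H := H^{bs-fld}_⊙`, hull map `ιO` + `hconst`} ∪ {[FrdII] Rmk 2.2.1 ×2 BY NAME: `h221`, `hex`} ∪ {the `def22Ctx` data `act`/`hact`}.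
[cite: MochizukiEtTh2009, Prop 4.2 p.88] -/
theorem Prop42Sub.prop42_iii_iv_mkOfConnectedTemperoid_of_def22Ctx
    (hΦd : Objectwise (fun M _ => IsDivisorial M) tf.divisorMonoid)
    (hDSpull : ∀ {A A' : ConnectedPart (BTemp X.Pi)} (e : A' ⟶ A) {a b : tf.Φ.carrier (op A)},
      (∀ x : tf.Φ.carrier (op A), x ∣ a → x ∣ b → x = 1) →
        ∀ y : tf.Φ.carrier (op A'), y ∣ pull tf.divisorMonoid e a → y ∣ pull tf.divisorMonoid e b → y = 1)
    (hR : ∀ (N : ℕ+) (A : ConnectedPart (BTemp X.Pi)), SemiGraphs.IsGaloisObj A.obj → ∀ f : tf.ratFnFunctor.obj (op A),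
      ∃ (A' : ConnectedPart (BTemp X.Pi)) (_ : SemiGraphs.IsGaloisObj A'.obj) (b : A' ⟶ A) (g : tf.ratFnFunctor.obj (op A')),
        g ^ (N : ℕ) = pull tf.ratFnFunctor b f)
    (hS : ∀ ⦃A B : ConnectedPart (BTemp X.Pi)⦄ (hA : SemiGraphs.IsGaloisObj A.obj) (hB : SemiGraphs.IsGaloisObj B.obj) (b : B ⟶ A),
      ∃ c : X.Pi, ∀ g : X.Pi, ((mkOfConnectedTemperoid X tf hZ hP NH A₀ hA₀ hA₀').galoisSurj B hB g).hom ≫ b =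
        b ≫ ((mkOfConnectedTemperoid X tf hZ hP NH A₀ hA₀ hA₀').galoisSurj A hA (c * g * c⁻¹)).hom)
    (hHn : (mkOfConnectedTemperoid X tf hZ hP NH A₀ hA₀ hA₀').HodotBsFld.Normal)
    (hHo : IsOpen ((mkOfConnectedTemperoid X tf hZ hP NH A₀ hA₀ hA₀').HodotBsFld : Set (Field.absoluteGaloisGroup K)))
    (hNH : ∀ (A : tf.category) (N : ℕ+), NH (mkOfConnectedTemperoid X tf hZ hP NH A₀ hA₀ hA₀').HodotBsFld A N →
      PadicKummer.IsNHSaturated (TemperedFrobenioid.def22Ctx X tf haug A (act A) (hact A)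
          (mkOfConnectedTemperoid X tf hZ hP NH A₀ hA₀ hA₀').HodotBsFld hHn hHo) N)
    (hNH' : ∀ (A : tf.category) (N : ℕ+),
      PadicKummer.IsNHSaturated (TemperedFrobenioid.def22Ctx X tf haug A (act A) (hact A)
          (mkOfConnectedTemperoid X tf hZ hP NH A₀ hA₀ hA₀').HodotBsFld hHn hHo) N →
        NH (mkOfConnectedTemperoid X tf hZ hP NH A₀ hA₀ hA₀').HodotBsFld A N)
    (hex : ∀ (A' : tf.category) (N : ℕ+), ∃ (A'' : tf.category) (ψ : A'' ⟶ A'),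
      PreFrobenioid.IsPullbackMorphism tf.toElem ψ ∧
        PadicKummer.IsNHSaturated (TemperedFrobenioid.def22Ctx X tf haug A'' (act A'') (hact A'')
          (mkOfConnectedTemperoid X tf hZ hP NH A₀ hA₀ hA₀').HodotBsFld hHn hHo) N)
    (h221 : ∀ (A'' : tf.category) (N : ℕ+), (A''.base ⟶ A₀.base) → PreFrobenioid.IsFrobeniusTrivial tf.toElem A'' →
      PadicKummer.SaturatedInvariantsAdmitRoots (TemperedFrobenioid.def22Ctx X tf haug A'' (act A'') (hact A'')
          (mkOfConnectedTemperoid X tf hZ hP NH A₀ hA₀ hA₀').HodotBsFld hHn hHo) N)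
    (ιO : ∀ A : tf.category,
      (TemperedFrobenioid.def22Ctx X tf haug A (act A) (hact A)
          (mkOfConnectedTemperoid X tf hZ hP NH A₀ hA₀ hA₀').HodotBsFld hHn hHo).O →* tf.ratFnFunctor.obj (op A.base))
    (hconst : ∀ (A'' : tf.category) (g : A''.base ⟶ A₀.base) (ξ : tf.ratFnFunctor.obj (op A₀.base)),
      PreFrobenioid.IsFrobeniusTrivial tf.toElem A'' →
      divB tf.divisorMonoid tf.ratFnFunctor tf.divBNatTrans (op A₀.base) ξ = 1 →
        ∃ f : (TemperedFrobenioid.def22Ctx X tf haug A'' (act A'') (hact A'')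
          (mkOfConnectedTemperoid X tf hZ hP NH A₀ hA₀ hA₀').HodotBsFld hHn hHo).O,
          (∀ h : (TemperedFrobenioid.def22Ctx X tf haug A'' (act A'') (hact A'')
          (mkOfConnectedTemperoid X tf hZ hP NH A₀ hA₀ hA₀').HodotBsFld hHn hHo).HA,
            (h : (TemperedFrobenioid.def22Ctx X tf haug A'' (act A'') (hact A'')
          (mkOfConnectedTemperoid X tf hZ hP NH A₀ hA₀ hA₀').HodotBsFld hHn hHo).AutE) • f = f) ∧
          ιO A'' f = pull tf.ratFnFunctor g ξ) :
    (mkOfConnectedTemperoid X tf hZ hP NH A₀ hA₀ hA₀').Prop42_iii (fun {_ _} φ x => tf.pullFracModel φ x) ∧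
      (mkOfConnectedTemperoid X tf hZ hP NH A₀ hA₀ hA₀').Prop42_iv (fun φ x => tf.pullFracModel φ x) :=
  Prop42Sub.prop42_iii_iv_mkOfModelCanonical_of_def22Reading X tf hZ hP _ _ _ NH A₀ hA₀ hA₀' hΦd hDSpull hR hS
    (fun A => TemperedFrobenioid.def22Ctx X tf haug A (act A) (hact A) _ hHn hHo) hNH hNH'
    (fun A h => isGalois_of_def22Ctx_isGalois (hZ := hZ) (hP := hP) (NH := NH) (A₀ := A₀) (hA₀ := hA₀) (hA₀' := hA₀')
      haug act hact _ hHn hHo A h)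
    (fun A N h => isMuSaturated_of_def22Ctx_isMuSaturated (hZ := hZ) (hP := hP) (NH := NH) (A₀ := A₀) (hA₀ := hA₀)
      (hA₀' := hA₀') haug act hact _ hHn hHo A N h) hex h221 ιO hconst

end BiKummerSetting

end Literature.AnabelianGeometry.EtaleTheta

end
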